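import Literature.AlgebraicGeometry.Motives.LineSweptQuadricSurfaces
import HarnessLib

/-!
# A cubic form along a line: `F(x + t z) = F(x) + t F'_x(z) + t² F'_z(x) + t³ F(z)`

R. Mboro, *Remarks on the `CH₂` of cubic hypersurfaces* (arXiv:1701.04488), Lemma 1.1 and the
proof of Prop. 1.4 (p. 8): the restriction of the cubic equation to a line, resp. to a `3`-plane
tangent to `X` along a line `l₀`, is read off from its Taylor coefficients ("the equation of `Y`
has the following form: `X_n Q + T`", "`span(x, l₀) ∩ S` is a plane cubic containing `l₀` with
multiplicity `2`"). This file is the algebra of that expansion for a cubic form `F` over a field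
`K` (infinite, for the coefficient identities):

* `ProjFamily.lineRestrict G x z = G(x + T z) ∈ K[T]`, its value, constant and linear
  coefficients (`coeff_one_lineRestrict`: the directional derivative
  `Σ_j z_j ∂F/∂x_j (x)`, by the first-order Taylor expansion
  `Resolution.sub_taylor_mem_ker_eval_sq`), and the degree bound for forms;
* `ProjFamily.dirD F y v = Σ_j v_j ∂F/∂x_j (y)` and the polar quadratic form
  `ProjFamily.polarForm F v = Σ_j v_j ∂F/∂x_j` of a cubic (`dirD F y v = (polarForm F v)(y)`);
* `ProjFamily.eval_add_smul_cubic` — **`F(x + t z) = F(x) + t F'_x(z) + t² F'_z(x) + t³ F(z)`**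
  for a cubic form (`F'_x(z) = dirD F x z`), by comparing `F(x + t z)` with `t³ F(t⁻¹ x + z)`.

Everything is proved; no named facts.

## References

* [Mboro2018] R. Mboro, Remarks on the CH₂ of cubic hypersurfaces, arXiv:1701.04488, Lemma 1.1
  (p. 6) and proof of Prop. 1.4 (p. 8).
* [Hartshorne1977] R. Hartshorne, Algebraic Geometry (1977), I Thm. 5.1 (Taylor expansion).
-/

noncomputable section

open MvPolynomial

universe u

namespace Literature.AlgebraicGeometry.Motives

namespace ProjFamily

open Literature.RingTheory.MvPolynomial ProjectiveSpaceCells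

/-! ### Restriction of a polynomial to a parametrised line -/

section LineRestrict

variable {K : Type*} [Field K] {σ : Type*}

/-- `G(x + T z) ∈ K[T]`: the restriction of `G` to the line through `x` with direction `z`.
[folklore] -/
def lineRestrict (G : MvPolynomial σ K) (x z : σ → K) : Polynomial K :=
  aeval (fun j => Polynomial.C (x j) + Polynomial.C (z j) * Polynomial.X) G

/-- `G(x + T z)(t) = G(x + t z)`. [folklore] -/
theorem eval_lineRestrict (G : MvPolynomial σ K) (x z : σ → K) (t : K) :
    (lineRestrict G x z).eval t = eval (x + t • z) G := by
  have hext : (Polynomial.evalRingHom t).comp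
      ((aeval fun j => Polynomial.C (x j) + Polynomial.C (z j) * Polynomial.X :
        MvPolynomial σ K →ₐ[K] Polynomial K) : MvPolynomial σ K →+* Polynomial K) = eval (x + t • z) := by
    refine MvPolynomial.ringHom_ext (fun c => ?_) (fun i => ?_)
    · rw [RingHom.comp_apply, RingHom.coe_coe, algHom_C, Polynomial.algebraMap_eq, Polynomial.coe_evalRingHom,
        Polynomial.eval_C, eval_C]
    · rw [RingHom.comp_apply, RingHom.coe_coe, aeval_X, Polynomial.coe_evalRingHom, eval_X]
      simp only [Polynomial.eval_add, Polynomial.eval_C, Polynomial.eval_mul, Polynomial.eval_X,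
        Pi.add_apply, Pi.smul_apply, smul_eq_mul]
      ring
  exact (DFunLike.congr_fun hext G :)

/-- The constant coefficient of `G(x + T z)` is `G(x)`. [folklore] -/
theorem coeff_zero_lineRestrict (G : MvPolynomial σ K) (x z : σ → K) :
    (lineRestrict G x z).coeff 0 = eval x G := by
  rw [Polynomial.coeff_zero_eq_eval_zero, eval_lineRestrict, zero_smul, add_zero]

/-- **The linear coefficient of `G(x + T z)` is the directional derivative `Σ_j z_j ∂G/∂x_j (x)`**
(first-order Taylor expansion `G ≡ G(x) + Σ_j ∂G/∂x_j(x) (X_j - x_j) mod 𝔞_x²`).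
[cite: Hartshorne1977, I Thm. 5.1 (proof)] -/
theorem coeff_one_lineRestrict [Fintype σ] (G : MvPolynomial σ K) (x z : σ → K) :
    (lineRestrict G x z).coeff 1 = ∑ j, z j * eval x (pderiv j G) := by
  classical
  let ψ : MvPolynomial σ K →ₐ[K] Polynomial K :=
    aeval fun j => Polynomial.C (x j) + Polynomial.C (z j) * Polynomial.X
  have hψC : ∀ c : K, ψ (C c) = Polynomial.C c := fun c => by
    simp only [ψ, algHom_C, Polynomial.algebraMap_eq]
  have hψX : ∀ j, ψ (X j) = Polynomial.C (x j) + Polynomial.C (z j) * Polynomial.X := fun j => by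
    simp only [ψ, aeval_X]
  have hψt : ∀ (t : K) (g : MvPolynomial σ K), (ψ g).eval t = eval (x + t • z) g :=
    fun t g => eval_lineRestrict g x z t
  -- `ψ (𝔞_x) ⊆ (T)`, hence `ψ (𝔞_x²) ⊆ (T²)`
  have hker : Ideal.map (ψ : MvPolynomial σ K →+* Polynomial K) (RingHom.ker (eval x)) ≤
      Ideal.span {(Polynomial.X : Polynomial K)} := by
    rw [Ideal.map_le_iff_le_comap]
    intro g hg
    rw [Ideal.mem_comap, Ideal.mem_span_singleton, Polynomial.X_dvd_iff, RingHom.coe_coe,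
      Polynomial.coeff_zero_eq_eval_zero, hψt, zero_smul, add_zero]
    exact (RingHom.mem_ker).1 hg
  have hker2 : Ideal.map (ψ : MvPolynomial σ K →+* Polynomial K) (RingHom.ker (eval x) ^ 2) ≤
      Ideal.span {(Polynomial.X ^ 2 : Polynomial K)} := by
    rw [Ideal.map_pow, ← Ideal.span_singleton_pow]
    exact Ideal.pow_right_mono hker 2
  have htay := Ideal.mem_map_of_mem (ψ : MvPolynomial σ K →+* Polynomial K)
    (Literature.AlgebraicGeometry.Resolution.sub_taylor_mem_ker_eval_sq x G)
  have hmem := hker2 htay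
  rw [Ideal.mem_span_singleton, Polynomial.X_pow_dvd_iff] at hmem
  have h1 := hmem 1 (by norm_num)
  rw [RingHom.coe_coe, map_sub, map_sub, map_sum, hψC, Polynomial.coeff_sub, Polynomial.coeff_sub,
    Polynomial.coeff_C_succ, sub_zero, Polynomial.finsetSum_coeff, sub_eq_zero] at h1
  change (ψ G).coeff 1 = _
  rw [h1]
  refine Finset.sum_congr rfl fun j _ => ?_
  rw [map_mul, hψC, map_sub, hψX, hψC, add_sub_cancel_left, ← mul_assoc, ← Polynomial.C_mul,
    Polynomial.coeff_C_mul, Polynomial.coeff_X_one, mul_one, mul_comm]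

/-- The restriction of a form of degree `n` to a line has degree `≤ n`. [folklore] -/
theorem natDegree_lineRestrict_le {G : MvPolynomial σ K} {n : ℕ} (hG : G.IsHomogeneous n)
    (x z : σ → K) : (lineRestrict G x z).natDegree ≤ n := by
  classical
  unfold lineRestrict
  rw [MvPolynomial.aeval_def, MvPolynomial.eval₂_eq]
  refine Polynomial.natDegree_sum_le_of_forall_le _ _ fun d hd => ?_
  refine (Polynomial.natDegree_C_mul_le _ _).trans ?_
  refine (Polynomial.natDegree_prod_le _ _).trans ?_
  rw [hG.degree_eq_sum_deg_support hd]
  refine Finset.sum_le_sum fun j _ => ?_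
  refine Polynomial.natDegree_pow_le.trans ?_
  have h1 : (Polynomial.C (x j) + Polynomial.C (z j) * Polynomial.X).natDegree ≤ 1 := by
    refine (Polynomial.natDegree_add_le _ _).trans ?_
    rw [Polynomial.natDegree_C, Nat.zero_max]
    exact (Polynomial.natDegree_C_mul_le _ _).trans Polynomial.natDegree_X_le
  calc d j * (Polynomial.C (x j) + Polynomial.C (z j) * Polynomial.X).natDegree ≤ d j * 1 :=
        Nat.mul_le_mul_left _ h1
    _ = d j := mul_one _

end LineRestrict

/-! ### The directional derivative and the polar quadratic forms of a cubic -/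

section Polar

variable {K : Type*} [Field K] {N : ℕ}

/-- The directional derivative `Σ_j v_j ∂F/∂x_j (y)` of `F` at `y` along `v`. [folklore] -/
def dirD (F : MvPolynomial (Fin (N + 1)) K) (y v : Fin (N + 1) → K) : K :=
  ∑ j, v j * eval y (pderiv j F)

/-- The polar form `Σ_j v_j ∂F/∂x_j` of `F` with respect to `v` (a quadratic form for a cubic `F`).
[folklore] -/
def polarForm (F : MvPolynomial (Fin (N + 1)) K) (v : Fin (N + 1) → K) : MvPolynomial (Fin (N + 1)) K :=
  ∑ j, v j • pderiv j F

/-- `F'_y(v) = (polarForm F v)(y)`. [folklore] -/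
theorem eval_polarForm (F : MvPolynomial (Fin (N + 1)) K) (y v : Fin (N + 1) → K) :
    eval y (polarForm F v) = dirD F y v := by
  unfold polarForm dirD
  rw [map_sum]
  refine Finset.sum_congr rfl fun j _ => ?_
  rw [smul_eq_C_mul, map_mul, eval_C]

/-- The polar form of a cubic is a quadratic form. [folklore] -/
theorem isHomogeneous_polarForm {F : MvPolynomial (Fin (N + 1)) K} (hF : F.IsHomogeneous 3)
    (v : Fin (N + 1) → K) : (polarForm F v).IsHomogeneous 2 := by
  unfold polarForm
  refine IsHomogeneous.sum _ _ _ fun j _ => ?_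
  rw [smul_eq_C_mul]
  exact (hF.pderiv (i := j)).C_mul _

/-- `dirD` is additive in the direction. [folklore] -/
theorem dirD_add_right (F : MvPolynomial (Fin (N + 1)) K) (y v w : Fin (N + 1) → K) :
    dirD F y (v + w) = dirD F y v + dirD F y w := by
  unfold dirD
  rw [← Finset.sum_add_distrib]
  refine Finset.sum_congr rfl fun j _ => ?_
  rw [Pi.add_apply, add_mul]

/-- `dirD` is homogeneous in the direction. [folklore] -/
theorem dirD_smul_right (F : MvPolynomial (Fin (N + 1)) K) (c : K) (y v : Fin (N + 1) → K) :
    dirD F y (c • v) = c * dirD F y v := by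
  unfold dirD
  rw [Finset.mul_sum]
  refine Finset.sum_congr rfl fun j _ => ?_
  rw [Pi.smul_apply, smul_eq_mul, mul_assoc]

/-- The polar form is additive in the direction. [folklore] -/
theorem polarForm_add (F : MvPolynomial (Fin (N + 1)) K) (v w : Fin (N + 1) → K) :
    polarForm F (v + w) = polarForm F v + polarForm F w := by
  unfold polarForm
  rw [← Finset.sum_add_distrib]
  refine Finset.sum_congr rfl fun j _ => ?_
  rw [Pi.add_apply, add_smul]

/-- The polar form is homogeneous in the direction. [folklore] -/
theorem polarForm_smul (F : MvPolynomial (Fin (N + 1)) K) (c : K) (v : Fin (N + 1) → K) :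
    polarForm F (c • v) = C c * polarForm F v := by
  unfold polarForm
  rw [Finset.mul_sum]
  refine Finset.sum_congr rfl fun j _ => ?_
  rw [Pi.smul_apply, smul_eq_mul, ← smul_eq_C_mul, smul_smul]

/-- Scalar extension of the polar form. [folklore] -/
theorem polarForm_map {k : Type*} [Field k] (ι : k →+* K) (F : MvPolynomial (Fin (N + 1)) k)
    (v : Fin (N + 1) → k) :
    polarForm (MvPolynomial.map ι F) (fun j => ι (v j)) = MvPolynomial.map ι (polarForm F v) := by
  unfold polarForm
  rw [map_sum]
  refine Finset.sum_congr rfl fun j _ => ?_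
  rw [smul_eq_C_mul, smul_eq_C_mul, map_mul, map_C, MvPolynomial.pderiv_map]

/-- `F'_y(v)` for a quadratic (or any) form along the base: `dirD F (c • y) v` for a form `F` of
degree `n + 1` scales like `cⁿ`. Here only the cubic case is needed: `F'_{c y}(v) = c² F'_y(v)`
(`2 ≠ 0`). [folklore] -/
theorem dirD_smul_left {F : MvPolynomial (Fin (N + 1)) K} (hF : F.IsHomogeneous 3) (h2 : (2 : K) ≠ 0)
    (c : K) (y v : Fin (N + 1) → K) : dirD F (c • y) v = c ^ 2 * dirD F y v := by
  rw [← eval_polarForm, ← eval_polarForm, eval_smul_eq_sq_mul (isHomogeneous_polarForm hF v) h2]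

end Polar

/-! ### The expansion of a cubic along a line -/

section Cubic

variable {K : Type*} [Field K] [Infinite K] {N : ℕ}

/-- Coefficients of a cubic polynomial vanishing at every non-zero scalar vanish. [folklore] -/
theorem coeffs_eq_zero_of_forall_ne_zero (c₀ c₁ c₂ c₃ : K)
    (h : ∀ t : K, t ≠ 0 → c₀ + c₁ * t + c₂ * t ^ 2 + c₃ * t ^ 3 = 0) :
    c₀ = 0 ∧ c₁ = 0 ∧ c₂ = 0 ∧ c₃ = 0 := by
  let p : Polynomial K := Polynomial.C c₀ + Polynomial.C c₁ * Polynomial.X +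
    Polynomial.C c₂ * Polynomial.X ^ 2 + Polynomial.C c₃ * Polynomial.X ^ 3
  have hp : p = 0 := by
    refine Polynomial.eq_zero_of_infinite_isRoot p ?_
    refine ((Set.finite_singleton (0 : K)).infinite_compl).mono fun t ht => ?_
    have ht0 : t ≠ 0 := fun h0 => ht (by rw [h0]; rfl)
    change p.IsRoot t
    rw [Polynomial.IsRoot.def]
    simp only [p, Polynomial.eval_add, Polynomial.eval_mul, Polynomial.eval_C, Polynomial.eval_X,
      Polynomial.eval_pow]
    exact h t ht0
  have h0 : p.coeff 0 = c₀ := by simp [p]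
  have h1 : p.coeff 1 = c₁ := by simp [p]
  have h2 : p.coeff 2 = c₂ := by simp [p]
  have h3 : p.coeff 3 = c₃ := by simp [p]
  rw [hp] at h0 h1 h2 h3
  simp only [Polynomial.coeff_zero] at h0 h1 h2 h3
  exact ⟨h0.symm, h1.symm, h2.symm, h3.symm⟩

/-- **The expansion of a cubic form along a line: `F(x + t z) = F(x) + t F'_x(z) + t² F'_z(x) +
t³ F(z)`** (`F'_x(z) = Σ_j z_j ∂F/∂x_j(x)`; Mboro, Lemma 1.1: "the restriction of `f` to `l`
writes `Σ μⁱ λ^{d-i} f_{d-i}(Y)`"). Proof: `F(x + t z) = t³ F(t⁻¹ x + z)` for `t ≠ 0`, both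
restrictions are cubic polynomials in `t`, and their two lowest coefficients are the value and the
directional derivative (`coeff_one_lineRestrict`). [cite: Mboro2018, Lemma 1.1 (arXiv:1701.04488, p. 6)] -/
theorem eval_add_smul_cubic {F : MvPolynomial (Fin (N + 1)) K} (hF : F.IsHomogeneous 3)
    (x z : Fin (N + 1) → K) (t : K) :
    eval (x + t • z) F = eval x F + t * dirD F x z + t ^ 2 * dirD F z x + t ^ 3 * eval z F := by
  classical
  set g := lineRestrict F x z with hg
  set h := lineRestrict F z x with hh
  have hgdeg : g.natDegree < 4 := Nat.lt_succ_of_le (natDegree_lineRestrict_le hF x z)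
  have hhdeg : h.natDegree < 4 := Nat.lt_succ_of_le (natDegree_lineRestrict_le hF z x)
  have hg4 : ∀ s : K, g.eval s = g.coeff 0 + g.coeff 1 * s + g.coeff 2 * s ^ 2 + g.coeff 3 * s ^ 3 := by
    intro s
    conv_lhs => rw [g.as_sum_range_C_mul_X_pow' hgdeg]
    simp [Finset.sum_range_succ, Polynomial.eval_add, Polynomial.eval_mul, Polynomial.eval_C,
      Polynomial.eval_pow, Polynomial.eval_X]
  have hh4 : ∀ s : K, h.eval s = h.coeff 0 + h.coeff 1 * s + h.coeff 2 * s ^ 2 + h.coeff 3 * s ^ 3 := by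
    intro s
    conv_lhs => rw [h.as_sum_range_C_mul_X_pow' hhdeg]
    simp [Finset.sum_range_succ, Polynomial.eval_add, Polynomial.eval_mul, Polynomial.eval_C,
      Polynomial.eval_pow, Polynomial.eval_X]
  -- `g(s) = s³ h(s⁻¹)` for `s ≠ 0`
  have hrel : ∀ s : K, s ≠ 0 → g.eval s = s ^ 3 * h.eval s⁻¹ := by
    intro s hs
    rw [hg, hh, eval_lineRestrict, eval_lineRestrict]
    have hvec : x + s • z = s • (z + s⁻¹ • x) := by
      rw [smul_add, smul_smul, mul_inv_cancel₀ hs, one_smul, add_comm (s • z)]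
    rw [hvec, eval_smul_of_isHomogeneous hF]
  -- compare coefficients
  have hcoef := coeffs_eq_zero_of_forall_ne_zero (g.coeff 0 - h.coeff 3) (g.coeff 1 - h.coeff 2)
    (g.coeff 2 - h.coeff 1) (g.coeff 3 - h.coeff 0) (by
      intro s hs
      have h1 := hrel s hs
      rw [hg4, hh4] at h1
      have hR : s ^ 3 * (h.coeff 0 + h.coeff 1 * s⁻¹ + h.coeff 2 * s⁻¹ ^ 2 + h.coeff 3 * s⁻¹ ^ 3) =
          h.coeff 0 * s ^ 3 + h.coeff 1 * s ^ 2 + h.coeff 2 * s + h.coeff 3 := by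
        field_simp
      rw [hR] at h1
      linear_combination h1)
  obtain ⟨-, -, h2c, h3c⟩ := hcoef
  have hg0 : g.coeff 0 = eval x F := coeff_zero_lineRestrict F x z
  have hg1 : g.coeff 1 = dirD F x z := coeff_one_lineRestrict F x z
  have hh0 : h.coeff 0 = eval z F := coeff_zero_lineRestrict F z x
  have hh1 : h.coeff 1 = dirD F z x := coeff_one_lineRestrict F z x
  have hg2 : g.coeff 2 = dirD F z x := by rw [← hh1]; exact sub_eq_zero.1 h2c
  have hg3 : g.coeff 3 = eval z F := by rw [← hh0]; exact sub_eq_zero.1 h3c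
  rw [← eval_lineRestrict, ← hg, hg4, hg0, hg1, hg2, hg3]
  ring

/-- **`F(x + z) = F(x) + F'_x(z) + F'_z(x) + F(z)`** for a cubic form. [cite: Mboro2018, Lemma 1.1 (arXiv:1701.04488, p. 6)] -/
theorem eval_add_cubic {F : MvPolynomial (Fin (N + 1)) K} (hF : F.IsHomogeneous 3)
    (x z : Fin (N + 1) → K) :
    eval (x + z) F = eval x F + dirD F x z + dirD F z x + eval z F := by
  have h := eval_add_smul_cubic hF x z 1
  rw [one_smul] at h
  rw [h]; ring

/-- **The directional derivative along an isotropic plane vanishes**: if `F ≡ 0` on `span(x, a)`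
(as a function of two parameters) then `F'_x(a) = 0`. [folklore] -/
theorem dirD_eq_zero_of_forall_eval_add_smul {F : MvPolynomial (Fin (N + 1)) K}
    {x a : Fin (N + 1) → K} (h : ∀ t : K, eval (x + t • a) F = 0) : dirD F x a = 0 := by
  classical
  exact sum_mul_eval_pderiv_eq_zero_of_forall_eval_add_smul F x a h

end Cubic

end ProjFamily

end Literature.AlgebraicGeometry.Motives
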